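import Summits.AtomisticToContinuum.Crystallization.Theorems.OverbindingBudgetWallTensionLever
import Summits.AtomisticToContinuum.Crystallization.Theses.ExcessDecayLiouville
import Literature.MathematicalPhysics.StatisticalMechanics.BarlowStacking

/-!
# `OverbindingBudget` / crux `RobustDefectLimitWindows` — the HALF-B KERNEL BRIDGE to route `ExcessDecayLiouville`

Helper for route `OverbindingBudget` (sub-problem `Crystallization`), crux
`Summit.AtomisticToContinuum.Crystallization.Theses.OverbindingBudget.RobustDefectLimitWindows`
(item `stmt-AtomisticToContinuum-31280`), registered skeleton «HostedDustCut» (v7), door half B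
`stub_corefreeRigidity` (COREFREE RIGIDITY: a μ-grand-canonical Lennard-Jones ground state at the limit
energy whose exact-`1/50` violators form `(D, 2D+6)`-separated bounded clusters in a `1/5`-Barlow matrix and
ALL of whose sites are corefree at `(1/10, 2/5)` has no violator at all).  Lineage `decomp-a2c-lens-4`,
generation 16; the critic (CRITIC-LEDGER row 175, q1) asked for this bridge at helper level.

Nothing here closes an item.  The file TYPES the pieces of the half-B chain and PROVES its glue:

* named binders of the stub (`TEND`, `LB`, `COV`, `SEP`, `Coarse`/`Corefree`; `GT`, `MAT` are the tree's);
* the interface notions `Developable` (a global chart: `Y` is the bijective image of ONE close-packed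
  reference stacking `barlowStacking 1 √(2/3) s` under a map sending touching reference pairs to pairs at
  distance within a fixed fraction of `a` — the contact graph is transported bijectively: no dislocation /
  vacancy / junction content), `GlobalBarlowMatch ε`
  (`Y` is two-way `ε`-close, uniformly over space, to ONE affine image `t₀ + A(reference stacking)` with
  admissible `A`), `GlobalHcpMatch` (verbatim the matching hypothesis of `ExcessDecayLiouville.HcpLiouville`:
  one admissible hcp two-lattice datum `(t, A)` with hcp-like inner displacement, `1/40`-matched on every
  ball), `Equil` (verbatim its force-balance hypothesis), `Sites t A` (verbatim its conclusion's site set);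
* the four NEW PIECES as `Prop`s — `CorefreeChart` (HB1, geometric, GS-free), `MuGSCForceBalance`
  (provable now), `LargeScaleRegularity` (B-large: ε-regularity from the `(1/10, 2/5)`-chart down to a
  global `1/40` Barlow match — the lens's own content), `StackingSelection` (B-stack: Barlow ↦ hcp) — the
  two IMPORTED pieces being the route-`ExcessDecayLiouville` items `HcpLiouville` (stmt-…-9332) and
  `PhononStability` (stmt-…-9333), cited BY NAME, never restated;
* PROVED glue: `exists_clean_of_sep_cov` (separated violators + covering ⇒ some site is clean),
  `gt_transfer` / `sites_translate` / `sites_reflect` / `sites_homogeneous` (an exact affine hcp two-lattice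
  is homogeneous for the purely metric clean test `GT`: lattice translations and the sublattice-swapping
  point reflection are isometries preserving the site set), and the composition
  `corefreeRigidity_of_pieces : CorefreeChart → MuGSCForceBalance → LargeScaleRegularity →
  StackingSelection → HcpLiouville → PhononStability → (half B)`, restated against the registered stub
  text in `stub_corefreeRigidity_of_pieces`.

All statements are over existing declarations; `sorry`-free.
-/

noncomputable section

namespace Summit.AtomisticToContinuum.Crystallization.Theorems.OverbindingBudgetCorefreeBridge

open Literature.MathematicalPhysics.StatisticalMechanics (UniformlyDiscrete lennardJones groundStateEnergy
  IsMuGSC barlowStacking IsHaggSeq triangularVec₁ triangularVec₂ layerNormal barlowOffset)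
open Literature.Geometry.DiscreteGeometry (ShellCloseTo fccKissingPattern hcpKissingPattern)
open Summit.AtomisticToContinuum.Crystallization.Theorems.OverbindingBudgetViolatorDensityFloor (GT)
open Summit.AtomisticToContinuum.Crystallization.Theorems.OverbindingBudgetWallTensionLever (MAT BarlowClose)

/-! ### §0 The `let`-bound predicates of `ExcessDecayLiouville.HcpLiouville`, verbatim
(same texts as `Theorems.CoarseGrains.Negative.PredicateAPI`, repeated here to keep the imports light) -/

/-- `ℝ³`. -/
abbrev E3 := EuclideanSpace ℝ (Fin 3)

/-- The period lattice `Λ = ℤu + ℤv + ℤ·2√(2/3)e₃` of the unit hcp stacking (verbatim from `HcpLiouville`). -/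
def Lam : Set E3 := {z | ∃ i j k : ℤ, z = (i : ℝ) • triangularVec₁ 1 + (j : ℝ) • triangularVec₂ 1 +
  (k : ℝ) • layerNormal (2 * Real.sqrt (2 / 3))}

/-- Two-way `ε`-matching of `X` with the sites `t m + A z` on the closed ball `B_r(c)` (verbatim). -/
def Near (X : Set E3) (c : E3) (r : ℝ) (t : Fin 2 → E3) (A : E3 →L[ℝ] E3) (ε : ℝ) : Prop :=
  (∀ p ∈ X, dist p c ≤ r → ∃ m : Fin 2, ∃ z ∈ Lam, dist p (t m + A z) ≤ ε) ∧
  (∀ m : Fin 2, ∀ z ∈ Lam, dist (t m + A z) c ≤ r → ∃ p ∈ X, dist p (t m + A z) ≤ ε)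

/-- Admissible cell: within `1/40` (operator norm) of `0.97·O`, `O` a linear isometry (verbatim). -/
def Adm (A : E3 →L[ℝ] E3) : Prop :=
  ∃ R : E3 ≃ₗᵢ[ℝ] E3, ‖A - (97 / 100 : ℝ) • (R.toContinuousLinearEquiv : E3 →L[ℝ] E3)‖ ≤ 1 / 40

/-- hcp-like inner displacement of the two sublattices (verbatim). -/
def Inner (t : Fin 2 → E3) (A : E3 →L[ℝ] E3) : Prop :=
  ‖t 1 - t 0 - A (barlowOffset 1 + layerNormal (Real.sqrt (2 / 3)))‖ ≤ 1 / 40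

/-- `Λ` is closed under addition. [folklore] -/
theorem lam_add_mem {z z' : E3} (hz : z ∈ Lam) (hz' : z' ∈ Lam) : z + z' ∈ Lam := by
  obtain ⟨i, j, k, rfl⟩ := hz
  obtain ⟨i', j', k', rfl⟩ := hz'
  refine ⟨i + i', j + j', k + k', ?_⟩
  push_cast
  simp only [add_smul]
  abel

/-- `Λ` is closed under negation. [folklore] -/
theorem lam_neg_mem {z : E3} (hz : z ∈ Lam) : -z ∈ Lam := by
  obtain ⟨i, j, k, rfl⟩ := hz
  refine ⟨-i, -j, -k, ?_⟩
  push_cast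
  simp only [neg_smul]
  abel

/-- `Λ` is closed under subtraction. [folklore] -/
theorem lam_sub_mem {z z' : E3} (hz : z ∈ Lam) (hz' : z' ∈ Lam) : z - z' ∈ Lam := by
  simpa [sub_eq_add_neg] using lam_add_mem hz (lam_neg_mem hz')

/-! ### §1 Named binders of the stub -/

/-- `e` is the limit of the ground-state energies per particle. -/
def TEND (e : ℝ) : Prop :=
  Filter.Tendsto (fun N : ℕ => groundStateEnergy lennardJones 3 N / N) Filter.atTop (nhds e)

/-- `e` bounds every finite ground-state energy per particle from below. -/
def LB (e : ℝ) : Prop :=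
  ∀ N : ℕ, 0 < N → e ≤ groundStateEnergy lennardJones 3 N / N

/-- Covering radius `< 9/10` (solid). -/
def COV (Y : Set E3) : Prop :=
  ∀ z : E3, ∃ w ∈ Y, dist z w < 9 / 10

/-- `(D, 2D+6)`-separation of the exact-`1/50` violators at spacing `a`. -/
def SEP (a D : ℝ) (Y : Set E3) : Prop :=
  ∀ p ∈ Y, ∀ q ∈ Y, ¬ GT a Y p → ¬ GT a Y q → (dist p q ≤ D ∨ 2 * D + 6 ≤ dist p q)

/-- The door's coarse test at `(1/10, 2/5)`: a `(1/10)`-good gapped twelve-shell that is `(2/5)`-close to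
the fcc or the hcp kissing pattern after rescaling by `a⁻¹` (verbatim the text inside `¬ ¬ (…)` of the stub). -/
def Coarse (a : ℝ) (Y : Set E3) (y : E3) : Prop :=
  ({v ∈ Y | v ≠ y ∧ dist y v ≤ a * (1 + 1 / 10)}.ncard = 12 ∧ ∀ v ∈ Y, v ≠ y → a * (1 - 1 / 10) ≤ dist y v ∧
      (dist y v ≤ a * (1 + 1 / 10) ∨ a * (63 / 50) ≤ dist y v)) ∧
    (∃ T : Finset (EuclideanSpace ℝ (Fin 3)), (↑T : Set (EuclideanSpace ℝ (Fin 3))) =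
        (fun v => a⁻¹ • (v - y)) '' {v ∈ Y | v ≠ y ∧ dist y v ≤ a * (1 + 1 / 10)} ∧
      (ShellCloseTo (2 / 5) T fccKissingPattern ∨ ShellCloseTo (2 / 5) T hcpKissingPattern))

/-- COREFREE: every site passes the coarse test (double negation as in the registered stub). -/
def Corefree (a : ℝ) (Y : Set E3) : Prop :=
  ∀ y ∈ Y, ¬ ¬ Coarse a Y y

/-! ### §2 Interface notions -/

/-- The unit close-packed reference stacking with Hägg sequence `s` (touching unit balls). -/
def RefStack (s : ℤ → ℤ) : Set E3 :=
  barlowStacking 1 (Real.sqrt (2 / 3)) s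

/-- DEVELOPABLE CHART with distortion `η` at spacing `a`: `Y` is the bijective image of ONE reference
close-packed stacking under a map `ψ` that sends touching reference pairs (distance `≤ 1`, i.e. `0` or `1`)
to pairs at distance within the fraction `η` of `a` (the contact graph is transported bijectively with
near-unit edges: no dislocation, vacancy, interstitial or junction content; the map may drift from any
affine map at large scales — only the edge lengths are controlled). -/
def Developable (η a : ℝ) (Y : Set E3) : Prop :=
  ∃ s : ℤ → ℤ, IsHaggSeq s ∧ ∃ ψ : E3 → E3, Set.BijOn ψ (RefStack s) Y ∧
    ∀ z ∈ RefStack s, ∀ z' ∈ RefStack s, dist z z' ≤ 1 →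
      |dist (ψ z) (ψ z') - a * dist z z'| ≤ η * (a * dist z z')

/-- GLOBAL BARLOW MATCH at tolerance `ε`: one Hägg sequence `s`, one translation `t₀` and one admissible
cell `A` such that `Y` and `t₀ + A(reference stacking)` are two-way `ε`-close uniformly over space. -/
def GlobalBarlowMatch (ε : ℝ) (Y : Set E3) : Prop :=
  ∃ s : ℤ → ℤ, IsHaggSeq s ∧ ∃ (t₀ : E3) (A : E3 →L[ℝ] E3), Adm A ∧
    (∀ p ∈ Y, ∃ z ∈ RefStack s, dist p (t₀ + A z) ≤ ε) ∧
    (∀ z ∈ RefStack s, ∃ p ∈ Y, dist p (t₀ + A z) ≤ ε)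

/-- GLOBAL HCP MATCH: verbatim the matching hypotheses of `ExcessDecayLiouville.HcpLiouville` — one
admissible hcp two-lattice datum with hcp-like inner displacement, two-way `1/40`-matched on every ball. -/
def GlobalHcpMatch (Y : Set E3) : Prop :=
  ∃ (t : Fin 2 → E3) (A : E3 →L[ℝ] E3), Adm A ∧ Inner t A ∧ ∀ (c : E3) (r : ℝ), Near Y c r t A (1 / 40)

/-- Force balance in `HasSum` form (verbatim the `Equil` of `ExcessDecayLiouville.HcpLiouville`). -/
def Equil (Y : Set E3) : Prop :=
  ∀ p ∈ Y, HasSum (fun q : {q : EuclideanSpace ℝ (Fin 3) // q ∈ Y ∧ q ≠ p} =>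
    (deriv lennardJones (dist p q.1) / dist p q.1) • (p - q.1)) 0

/-- The site set of the two-lattice datum `(t, A)` (verbatim the `Sites` of `HcpLiouville`). -/
def Sites (t : Fin 2 → E3) (A : E3 →L[ℝ] E3) : Set E3 :=
  {p | ∃ m : Fin 2, ∃ z ∈ Lam, p = t m + A z}

/-! ### §3 The pieces of the half-B chain -/

/-- **HB1 — COREFREE CHART** (geometric, GS-free; difficulty M–L): a uniformly discrete solid set whose
clean sites are `1/5`-Barlow and all of whose sites pass the `(1/10, 2/5)` coarse test is developable on ONE
reference close-packed stacking with edge distortion `1/5` (the natural chart sends reference neighbours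
to `(1/10)`-shell members, distortion `≤ 1/10`).  Why it might fail: a corefree texture whose local
Barlow charts switch the layering direction through `(2/5)`-ambiguous (strongly sheared, bct-like) regions,
or a corefree coherent junction line of differently oriented lamellae (non-trivial holonomy). -/
def CorefreeChart : Prop :=
  ∀ Y : Set E3, UniformlyDiscrete Y → COV Y → ∀ a : ℝ, 47 / 50 ≤ a → a ≤ 1 →
    MAT a Y → Corefree a Y → Developable (1 / 5) a Y

/-- **FORCE BALANCE OF μ-GROUND STATES** (provable now; difficulty M): moving one particle is an admissible
finite modification, so every site minimises its field energy over the open complement of the other sites;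
Fermat + termwise differentiation of the absolutely convergent LJ field (`|V′| ≤ C r⁻⁷`, uniform discreteness)
give the `HasSum` force balance.  (Finite version: `ExcessDecayLiouville.ForceBalance`, item 9335, closed.) -/
def MuGSCForceBalance : Prop :=
  ∀ (e : ℝ) (Y : Set E3), UniformlyDiscrete Y → IsMuGSC lennardJones e Y → Equil Y

/-- **B-large — LARGE-SCALE REGULARITY** (the lens's own content; difficulty XL; TRUE-type): a corefree,
developable μ-grand-canonical LJ ground state at the limit energy per particle is, uniformly over space,
two-way `1/40`-close to ONE affine image of a close-packed stacking with admissible cell.  Chain inside: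
zero excess energy density at `μ = e⋆` (landed cube bookkeeping) + energy coercivity modulo rotations in the
chart (CITED lever #3 / `PhononStability`-type constants, not re-minted) + FJM rigidity ⇒ `L²`-flatness on
large cubes; ε-regularity from the `(1/10)`-chart down to `1/40` (`ExcessDecay`, item 9334, is the `1/40`-end);
exact zero strain ⇒ one global rotation (Liouville–Reshetnyak).  KILL-WATCH: false if a μ-ground state can
be a corefree COHERENTLY TWINNED polycrystal (needs a corefree junction line — census I-B16 proper) or can
carry a bounded `≥ 1/40` elastic bump (I-B9-lite found none); logarithmic rotation drift (F. John) is
GS-free only and is excluded here by minimality, which is exactly what this piece must prove. -/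
def LargeScaleRegularity : Prop :=
  ∀ e : ℝ, TEND e → LB e → ∀ Y : Set E3, UniformlyDiscrete Y → IsMuGSC lennardJones e Y → COV Y →
    ∀ a : ℝ, 47 / 50 ≤ a → a ≤ 1 → MAT a Y → Corefree a Y → Developable (1 / 5) a Y →
      GlobalBarlowMatch (1 / 40) Y

/-- **B-stack — STACKING SELECTION** (difficulty L as typed; TRUE-type): at `μ = e⋆` a global `1/40` Barlow
match is a global hcp match — positive c-layer density is excluded by zero excess density and the strict hcp
preference of the LJ layer couplings (`BarlowStackingEnergy` bookkeeping + the certified sign inequalities of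
item 0628 «stacking selection», cited), a zero-density family of faults / fcc lamellae by the partial-loop
competitor at radius `≈ 3·10⁴` (fault energy `∝ R²` against loop energy `∝ R log R`).  With the item's
two-way recurrence binder (absent from the v7 stub) the second half becomes trivial (a recurring fault has
positive density) and the piece drops to S–M. -/
def StackingSelection : Prop :=
  ∀ e : ℝ, TEND e → LB e → ∀ Y : Set E3, UniformlyDiscrete Y → IsMuGSC lennardJones e Y →
    GlobalBarlowMatch (1 / 40) Y → GlobalHcpMatch Y

/-! ### §4 Proved glue I: separated violators + covering ⇒ a clean site -/

/-- If the violators are `(D, 2D+6)`-separated (`0 ≤ D`) and `Y` is `9/10`-covering, then `Y` has a clean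
site: otherwise every site is a violator, and a site within `9/10` of the point at distance `D + 3` from a
given site lies at a forbidden distance in `(D, 2D+6)`. [folklore] -/
theorem exists_clean_of_sep_cov {Y : Set E3} {a D : ℝ} (hD : 0 ≤ D) (hcov : COV Y) (hsep : SEP a D Y)
    {y : E3} (hy : y ∈ Y) : ∃ q ∈ Y, GT a Y q := by
  by_contra h
  push Not at h
  set v : E3 := EuclideanSpace.single 0 (1 : ℝ) with hv
  have hvn : ‖v‖ = 1 := by
    rw [hv, PiLp.norm_single, norm_one]
  set c : E3 := y + (D + 3) • v with hc
  have hyc : dist y c = D + 3 := by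
    rw [hc, dist_eq_norm, show y - (y + (D + 3) • v) = -((D + 3) • v) by abel, norm_neg, norm_smul,
      hvn, mul_one, Real.norm_eq_abs, abs_of_nonneg (by linarith)]
  obtain ⟨w, hw, hcw⟩ := hcov c
  have h1 : dist y c ≤ dist y w + dist w c := dist_triangle y w c
  have h2 : dist y w ≤ dist y c + dist c w := dist_triangle y c w
  rw [dist_comm w c] at h1
  rcases hsep y hy w hw (h y hy) (h w hw) with h3 | h3 <;> linarith

/-! ### §5 Proved glue II: an exact affine hcp two-lattice is homogeneous for the clean test -/

/-- The clean test `GT a S ·` is transported by any distance-preserving self-map of space that maps `S`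
onto itself. [folklore] -/
theorem gt_transfer {S : Set E3} {g : E3 → E3} (hg : ∀ u v : E3, dist (g u) (g v) = dist u v)
    (hS : g '' S = S) {a : ℝ} {p : E3} (hp : GT a S p) : GT a S (g p) := by
  have hinj : Function.Injective g := by
    intro u v huv
    have := hg u v
    rw [huv, dist_self] at this
    exact dist_eq_zero.1 this.symm
  obtain ⟨hcard, hall⟩ := hp
  refine ⟨?_, ?_⟩
  · have hset : {w ∈ S | w ≠ g p ∧ dist (g p) w ≤ a * (1 + 1 / 50)} =
        g '' {w ∈ S | w ≠ p ∧ dist p w ≤ a * (1 + 1 / 50)} := by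
      ext w
      constructor
      · rintro ⟨hwS, hne, hd⟩
        have hw' : w ∈ g '' S := by rw [hS]; exact hwS
        obtain ⟨w₀, hw₀, rfl⟩ := hw'
        refine ⟨w₀, ⟨hw₀, fun h0 => hne (by rw [h0]), ?_⟩, rfl⟩
        rwa [hg] at hd
      · rintro ⟨w₀, ⟨hw₀, hne, hd⟩, rfl⟩
        refine ⟨?_, fun h0 => hne (hinj h0), ?_⟩
        · rw [← hS]; exact ⟨w₀, hw₀, rfl⟩
        · rwa [hg]
    rw [hset, Set.ncard_image_of_injective _ hinj, hcard]
  · intro w hwS hne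
    have hw' : w ∈ g '' S := by rw [hS]; exact hwS
    obtain ⟨w₀, hw₀, rfl⟩ := hw'
    have hne₀ : w₀ ≠ p := fun h0 => hne (by rw [h0])
    rw [hg]
    exact hall w₀ hw₀ hne₀

/-- Lattice translations preserve the two-lattice site set. [folklore] -/
theorem sites_translate (t : Fin 2 → E3) (A : E3 →L[ℝ] E3) {z₁ : E3} (hz₁ : z₁ ∈ Lam) :
    (fun v => v + A z₁) '' Sites t A = Sites t A := by
  ext p
  constructor
  · rintro ⟨v, ⟨m, z, hz, rfl⟩, rfl⟩
    exact ⟨m, z + z₁, lam_add_mem hz hz₁, by rw [map_add]; abel⟩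
  · rintro ⟨m, z, hz, rfl⟩
    refine ⟨t m + A (z - z₁), ⟨m, z - z₁, lam_sub_mem hz hz₁, rfl⟩, ?_⟩
    show t m + A (z - z₁) + A z₁ = t m + A z
    rw [map_sub]; abel

/-- The point reflection through the midpoint of `t 0` and `t 1` swaps the two sublattices and preserves the
site set. [folklore] -/
theorem sites_reflect (t : Fin 2 → E3) (A : E3 →L[ℝ] E3) :
    (fun v => t 0 + t 1 - v) '' Sites t A = Sites t A := by
  have key : ∀ (m : Fin 2) (z : E3), z ∈ Lam → t 0 + t 1 - (t m + A z) ∈ Sites t A := by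
    intro m z hz
    fin_cases m
    · exact ⟨1, -z, lam_neg_mem hz, by rw [map_neg]; simp; abel⟩
    · exact ⟨0, -z, lam_neg_mem hz, by rw [map_neg]; simp; abel⟩
  ext p
  constructor
  · rintro ⟨v, ⟨m, z, hz, rfl⟩, rfl⟩
    exact key m z hz
  · rintro ⟨m, z, hz, rfl⟩
    refine ⟨t 0 + t 1 - (t m + A z), key m z hz, ?_⟩
    show t 0 + t 1 - (t 0 + t 1 - (t m + A z)) = t m + A z
    abel

/-- **Homogeneity**: in an exact affine two-lattice `Sites t A` all sites are equivalent for the clean test —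
if one site is exactly `1/50`-clean at spacing `a`, every site is. [folklore] -/
theorem sites_homogeneous {t : Fin 2 → E3} {A : E3 →L[ℝ] E3} {a : ℝ} {y₀ y : E3}
    (hy₀ : y₀ ∈ Sites t A) (hy : y ∈ Sites t A) (h : GT a (Sites t A) y₀) : GT a (Sites t A) y := by
  obtain ⟨m₀, z₀, hz₀, rfl⟩ := hy₀
  obtain ⟨m, z, hz, rfl⟩ := hy
  -- translations and the point reflection are isometries
  have htr : ∀ d : E3, ∀ u v : E3, dist ((fun w => w + d) u) ((fun w => w + d) v) = dist u v :=
    fun d u v => by simp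
  have hrf : ∀ u v : E3, dist ((fun w => t 0 + t 1 - w) u) ((fun w => t 0 + t 1 - w) v) = dist u v :=
    fun u v => by
      simp only [dist_eq_norm]
      rw [show t 0 + t 1 - u - (t 0 + t 1 - v) = v - u by abel, norm_sub_rev]
  by_cases hm : m = m₀
  · subst hm
    have h1 : GT a (Sites t A) (t m + A z₀ + A (z - z₀)) :=
      gt_transfer (htr (A (z - z₀))) (sites_translate t A (lam_sub_mem hz hz₀)) h
    have hpt : t m + A z₀ + A (z - z₀) = t m + A z := by
      rw [map_sub]; abel
    rwa [hpt] at h1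
  · -- reflect (lands on the other sublattice at `-z₀`), then translate by `A (z + z₀)`
    have h1 : GT a (Sites t A) (t 0 + t 1 - (t m₀ + A z₀)) := gt_transfer hrf (sites_reflect t A) h
    have hpt1 : t 0 + t 1 - (t m₀ + A z₀) = t m + A (-z₀) := by
      fin_cases m₀ <;> fin_cases m <;> simp [map_neg] at hm ⊢ <;> abel
    rw [hpt1] at h1
    have h2 : GT a (Sites t A) (t m + A (-z₀) + A (z + z₀)) :=
      gt_transfer (htr (A (z + z₀))) (sites_translate t A (lam_add_mem hz hz₀)) h1
    have hpt2 : t m + A (-z₀) + A (z + z₀) = t m + A z := by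
      rw [map_neg, map_add]; abel
    rwa [hpt2] at h2

/-! ### §6 The composition: half B from the pieces -/

/-- **HALF B FROM THE PIECES.**  Chart (HB1) ⇒ large-scale regularity (B-large) gives a global `1/40` Barlow
match ⇒ stacking selection (B-stack) makes it a global hcp match ⇒ with force balance (μ-ground states) and
separation (uniform discreteness), `HcpLiouville` — its harmonic-stability hypothesis discharged LITERALLY by
`PhononStability` — makes `Y` an exact admissible affine hcp two-lattice ⇒ homogeneity transports the
cleanness of the one clean site that `(D, 2D+6)`-separation + covering provide to every site. -/
theorem corefreeRigidity_of_pieces (hC : CorefreeChart) (hF : MuGSCForceBalance)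
    (hL : LargeScaleRegularity) (hS : StackingSelection)
    (h9332 : Summit.AtomisticToContinuum.Crystallization.Theses.ExcessDecayLiouville.HcpLiouville)
    (h9333 : Summit.AtomisticToContinuum.Crystallization.Theses.ExcessDecayLiouville.PhononStability) :
    ∀ e : ℝ, TEND e → LB e → ∀ Y : Set E3, UniformlyDiscrete Y → IsMuGSC lennardJones e Y → COV Y →
      ∀ a : ℝ, 47 / 50 ≤ a → a ≤ 1 → ∀ D : ℝ, 0 ≤ D → D ≤ 13 → SEP a D Y → MAT a Y → Corefree a Y →
        ∀ y ∈ Y, GT a Y y := by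
  intro e hT hLB Y hUD hμ hcov a ha1 ha2 D hD0 _hD13 hsep hMAT hcore y hy
  have hchart : Developable (1 / 5) a Y := hC Y hUD hcov a ha1 ha2 hMAT hcore
  have hGB : GlobalBarlowMatch (1 / 40) Y := hL e hT hLB Y hUD hμ hcov a ha1 ha2 hMAT hcore hchart
  obtain ⟨t, A, hA, hI, hNear⟩ := hS e hT hLB Y hUD hμ hGB
  have hEq : Equil Y := hF e Y hUD hμ
  obtain ⟨q, hq, hclean⟩ := exists_clean_of_sep_cov hD0 hcov hsep hy
  obtain ⟨δ, hδ, hsepδ⟩ := hUD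
  obtain ⟨t', A', _hA', hYeq⟩ := h9332 h9333 δ hδ Y hsepδ hEq t A hA hI hNear
  have hYS : Y = Sites t' A' := hYeq
  subst hYS
  exact sites_homogeneous hq hy hclean

/-- The same, stated against the REGISTERED text of `stub_corefreeRigidity` (skeleton «HostedDustCut» v7 on
stmt-AtomisticToContinuum-31280, byte-identical): the four new pieces and the two `ExcessDecayLiouville`
items imply door half B. -/
theorem stub_corefreeRigidity_of_pieces (hC : CorefreeChart) (hF : MuGSCForceBalance)
    (hL : LargeScaleRegularity) (hS : StackingSelection)
    (h9332 : Summit.AtomisticToContinuum.Crystallization.Theses.ExcessDecayLiouville.HcpLiouville)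
    (h9333 : Summit.AtomisticToContinuum.Crystallization.Theses.ExcessDecayLiouville.PhononStability) :
    ∀ e : ℝ, Filter.Tendsto (fun N : ℕ => Literature.MathematicalPhysics.StatisticalMechanics.groundStateEnergy Literature.MathematicalPhysics.StatisticalMechanics.lennardJones 3 N / N) Filter.atTop (nhds e) → (∀ N : ℕ, 0 < N → e ≤ Literature.MathematicalPhysics.StatisticalMechanics.groundStateEnergy Literature.MathematicalPhysics.StatisticalMechanics.lennardJones 3 N / N) → ∀ Y : Set (EuclideanSpace ℝ (Fin 3)), Literature.MathematicalPhysics.StatisticalMechanics.UniformlyDiscrete Y → Literature.MathematicalPhysics.StatisticalMechanics.IsMuGSC Literature.MathematicalPhysics.StatisticalMechanics.lennardJones e Y → (∀ z : EuclideanSpace ℝ (Fin 3), ∃ w ∈ Y, dist z w < 9 / 10) → ∀ a : ℝ, 47 / 50 ≤ a → a ≤ 1 → ∀ D : ℝ, 0 ≤ D → D ≤ 13 → (∀ p ∈ Y, ∀ q ∈ Y, ¬ ({w ∈ Y | w ≠ p ∧ dist p w ≤ a * (1 + 1 / 50)}.ncard = 12 ∧ ∀ w ∈ Y, w ≠ p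 → a * (1 - 1 / 50) ≤ dist p w ∧ (dist p w ≤ a * (1 + 1 / 50) ∨ a * (63 / 50) ≤ dist p w)) → ¬ ({w ∈ Y | w ≠ q ∧ dist q w ≤ a * (1 + 1 / 50)}.ncard = 12 ∧ ∀ w ∈ Y, w ≠ q → a * (1 - 1 / 50) ≤ dist q w ∧ (dist q w ≤ a * (1 + 1 / 50) ∨ a * (63 / 50) ≤ dist q w)) → (dist p q ≤ D ∨ 2 * D + 6 ≤ dist p q)) → (∀ y ∈ Y, ({w ∈ Y | w ≠ y ∧ dist y w ≤ a * (1 + 1 / 50)}.ncard = 12 ∧ ∀ w ∈ Y, w ≠ y → a * (1 - 1 / 50) ≤ dist y w ∧ (dist y w ≤ a * (1 + 1 / 50) ∨ a * (63 / 50) ≤ dist y w)) → (∃ T : Finset (EuclideanSpace ℝ (Fin 3)), (↑T : Set (EuclideanSpace ℝ (Fin 3))) = (fun w => a⁻¹ • (w - y)) '' {w ∈ Y | w ≠ y ∧ dist y w ≤ a * (1 + 1 / 50)} ∧ (Literature.Geometry.DiscreteGeometry.ShellCloseTo (1 / 5) T Literature.Geometry.DiscreteGeometry.fccKissingPattern ∨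 Literature.Geometry.DiscreteGeometry.ShellCloseTo (1 / 5) T Literature.Geometry.DiscreteGeometry.hcpKissingPattern))) → (∀ y ∈ Y, ¬ ¬ (({v ∈ Y | v ≠ y ∧ dist y v ≤ a * (1 + 1 / 10)}.ncard = 12 ∧ ∀ v ∈ Y, v ≠ y → a * (1 - 1 / 10) ≤ dist y v ∧ (dist y v ≤ a * (1 + 1 / 10) ∨ a * (63 / 50) ≤ dist y v)) ∧ (∃ T : Finset (EuclideanSpace ℝ (Fin 3)), (↑T : Set (EuclideanSpace ℝ (Fin 3))) = (fun v => a⁻¹ • (v - y)) '' {v ∈ Y | v ≠ y ∧ dist y v ≤ a * (1 + 1 / 10)} ∧ (Literature.Geometry.DiscreteGeometry.ShellCloseTo (2 / 5) T Literature.Geometry.DiscreteGeometry.fccKissingPattern ∨ Literature.Geometry.DiscreteGeometry.ShellCloseTo (2 / 5) T Literature.Geometry.DiscreteGeometry.hcpKissingPattern)))) → ∀ y ∈ Y, ({w ∈ Y | w ≠ y ∧ dist y w ≤ a * (1 + 1 / 50)}.ncard = 12 ∧ ∀ w ∈ Y, w ≠ y → a * (1 - 1 / 50) ≤ dist y w ∧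 (dist y w ≤ a * (1 + 1 / 50) ∨ a * (63 / 50) ≤ dist y w)) := by
  intro e hT hLB Y hUD hμ hcov a ha1 ha2 D hD0 hD13 hsep hMAT hcore
  exact corefreeRigidity_of_pieces hC hF hL hS h9332 h9333 e hT hLB Y hUD hμ hcov a ha1 ha2 D hD0 hD13 hsep hMAT hcore

end Summit.AtomisticToContinuum.Crystallization.Theorems.OverbindingBudgetCorefreeBridge

end
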